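import Literature.Geometry.Symplectic.SurfaceNormalData
import HarnessLib

/-!
# The corrected normal retraction of a symplectic surface and its normal coordinate

Topic `Literature/Geometry/Symplectic`; third layer (C2a) of the construction of the symplectic
tubular neighbourhood with its `U(1)`-structure of a closed symplectic surface `b : S → N` in a
symplectic `4`-manifold (McLean, GAFA 2012, **Lemma 5.14**, `k = 1`; McDuff–Salamon 2017,
Thm. 3.4.10), for the fact seat of
`Literature.Geometry.Symplectic.mclean_divisorComplement_convex_four`.

For a `Setup` `D` (see `SurfaceNormalData.lean`: `s, e, b`, `f = e ∘ b`, the planes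
`TS y ≤ TN y ⊆ V`, the Euclidean normal plane `F y` with projection `Q y`, the symplectic
projection `symProj y`) with `S` compact we build, following Hirsch's embedded treatment of
tubular neighbourhoods (the tree's `NormalRetraction.lean`):

* the normal retraction `r : V → S` of `f` on its open normal tube (`rad`, `nTube`,
  `contMDiffOn_r`, `r_add`), its differential at the surface (`mfderiv_r_mfderiv_f : dr ∘ df = id`,
  `mfderiv_r_apply_of_mem_orthogonal : dr = 0` on normal vectors, `mfderiv_f_mfderiv_r :
  df ∘ dr = Pˢ`), and the retraction `π₀ = r ∘ e` of the open set `N₀ = e⁻¹(tube) ⊇ b(S)`;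
* the **corrected retraction** `π₁ x = r (e x + A_{π₀ x}(e x - f (π₀ x)))`,
  `A y = symProj y ∘ Q y`, smooth on an open set `N₁ ⊇ b(S)` with `π₁ ∘ b = id`, whose fibres
  are SYMPLECTICALLY orthogonal to the surface: `df (dπ₁ v) = Pˢ(de v) + symProj (Q (de v))`
  (`mfderiv_f_mfderiv_π₁`), so that `ker dπ₁ = {Q w - symProj (Q w)} = TS^ω` at the points of
  the surface;
* the **normal coordinate** `nrm x = Q_{π₁ x}(e x - f (π₁ x)) ∈ F (π₁ x)`, smooth on `N₁`,
  vanishing exactly to first order along the surface with `d(nrm)_{b y} v = Q_y (de v)`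
  (`mfderiv_nrm`), whence `x ↦ (π₁ x, nrm x)` is an immersion along the surface
  (`eq_zero_of_mfderiv_π₁_eq_zero_of_mfderiv_nrm_eq_zero`).

Everything here is proved; no named facts (D-0026).

## References

* M. McLean, *The growth rate of symplectic homology and affine varieties*, GAFA 22 (2012),
  Lemma 5.14, pp. 35–37 (arXiv:1011.2542). [Mclean2012]
* D. McDuff, D. Salamon, *Introduction to Symplectic Topology*, 3rd ed. (2017), Thm. 3.4.10.
  [McDuffSalamon2017]
* M. W. Hirsch, *Differential Topology* (1976), Ch. 4 §5, Thms. 5.1–5.2. [HirschDT1976]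
-/

noncomputable section

open scoped Manifold ContDiff Topology RealInnerProductSpace
open Set Function Module Filter
open Literature.Topology.FourManifolds
open Literature.Geometry.Kaehler
open Literature.Geometry.Manifold

namespace Literature.Geometry.Symplectic

/-! ### A product rule at a zero (manifold source, vector values) -/

section ProductRule

variable {E : Type*} [NormedAddCommGroup E] [NormedSpace ℝ E] {H : Type*} [TopologicalSpace H]
  {I : ModelWithCorners ℝ E H} {M : Type*} [TopologicalSpace M] [ChartedSpace H M]
  {F₁ F₂ : Type*} [NormedAddCommGroup F₁] [NormedSpace ℝ F₁] [NormedAddCommGroup F₂]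
  [NormedSpace ℝ F₂]

/-- **Product rule at a zero**: for differentiable `g : M → F₁ →L F₂` and `f : M → F₁` with
`f x = 0`, `d(y ↦ g y (f y))_x v = g x (df_x v)`. [folklore] -/
theorem mfderiv_clm_apply_of_eq_zero {g : M → F₁ →L[ℝ] F₂} {f : M → F₁} {x : M}
    (hg : MDifferentiableAt I 𝓘(ℝ, F₁ →L[ℝ] F₂) g x) (hf : MDifferentiableAt I 𝓘(ℝ, F₁) f x)
    (h0 : f x = 0) (v : TangentSpace I x) :
    mfderiv I 𝓘(ℝ, F₂) (fun y ↦ g y (f y)) x v = g x (mfderiv I 𝓘(ℝ, F₁) f x v) := by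
  have hb := (isBoundedBilinearMap_apply (𝕜 := ℝ) (E := F₁) (F := F₂)).hasFDerivAt (g x, f x)
  have hpair : HasMFDerivAt I 𝓘(ℝ, (F₁ →L[ℝ] F₂) × F₁) (fun y ↦ (g y, f y)) x
      ((mfderiv I 𝓘(ℝ, F₁ →L[ℝ] F₂) g x).prod (mfderiv I 𝓘(ℝ, F₁) f x)) :=
    ⟨hg.hasMFDerivAt.1.prodMk hf.hasMFDerivAt.1, hg.hasMFDerivAt.2.prodMk hf.hasMFDerivAt.2⟩
  have hcomp := HasMFDerivAt.comp x hb.hasMFDerivAt hpair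
  have hfun : (fun y ↦ g y (f y)) = (fun p : (F₁ →L[ℝ] F₂) × F₁ ↦ p.1 p.2) ∘ fun y ↦ (g y, f y) :=
    rfl
  rw [hfun, hcomp.mfderiv]
  show (isBoundedBilinearMap_apply (𝕜 := ℝ) (E := F₁) (F := F₂)).deriv (g x, f x)
    (mfderiv I 𝓘(ℝ, F₁ →L[ℝ] F₂) g x v, mfderiv I 𝓘(ℝ, F₁) f x v) = _
  rw [IsBoundedBilinearMap.deriv_apply, h0, map_zero, add_zero]

end ProductRule

namespace SurfaceTube

variable {N : Type*} [TopologicalSpace N] [ChartedSpace (EuclideanSpace ℝ (Fin 4)) N]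
  [IsManifold (𝓡 4) ∞ N] {S : Type*} [TopologicalSpace S] [ChartedSpace (EuclideanSpace ℝ (Fin 2)) S]
  [IsManifold (𝓡 2) ∞ S] {V : Type*} [NormedAddCommGroup V] [InnerProductSpace ℝ V]
  [FiniteDimensional ℝ V] (D : Setup N S V)

namespace Setup

/-! ### The differentials of `e` and `f` as `V`-valued maps

The tangent spaces `TangentSpace 𝓘(ℝ, V) z` of the vector space `V` are definitionally `V`;
we fix `V`-valued names for the differentials so that all linear algebra happens in `V`. -/

/-- `de_x : T_x N →L V`. [folklore] -/
def de (x : N) : TangentSpace (𝓡 4) x →L[ℝ] V := mfderiv (𝓡 4) 𝓘(ℝ, V) D.e x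

/-- `df_y : T_y S →L V`. [folklore] -/
def df (y : S) : TangentSpace (𝓡 2) y →L[ℝ] V := mfderiv (𝓡 2) 𝓘(ℝ, V) D.f y

/-- Unfolding of `de`. [folklore] -/
theorem de_apply (x : N) (v : TangentSpace (𝓡 4) x) : D.de x v = mfderiv (𝓡 4) 𝓘(ℝ, V) D.e x v :=
  rfl

/-- Unfolding of `df`. [folklore] -/
theorem df_apply (y : S) (c : TangentSpace (𝓡 2) y) : D.df y c = mfderiv (𝓡 2) 𝓘(ℝ, V) D.f y c :=
  rfl

/-- `df c = de (db c)`. [folklore] -/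
theorem df_eq_de_mfderiv_b (y : S) (c : TangentSpace (𝓡 2) y) :
    D.df y c = D.de (D.b y) (mfderiv (𝓡 2) (𝓡 4) D.b y c) :=
  D.mfderiv_f_apply y c

/-- `de v ∈ TN`. [folklore] -/
theorem de_mem_TN (y : S) (v : TangentSpace (𝓡 4) (D.b y)) : D.de (D.b y) v ∈ D.TN y := ⟨v, rfl⟩

/-- `df c ∈ TS`. [folklore] -/
theorem df_mem_TS (y : S) (c : TangentSpace (𝓡 2) y) : D.df y c ∈ D.TS y := ⟨c, rfl⟩

/-- `de` is injective. [folklore] -/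
theorem de_injective (x : N) : Injective (D.de x) := D.hde x

/-- `df` is injective. [folklore] -/
theorem df_injective (y : S) : Injective (D.df y) := D.hdf y

/-- **Orthogonal splitting of `de v`**: `de v = Pˢ (de v) + Q (de v)`. [folklore] -/
theorem tangentProj_de_add_Q_de (y : S) (v : TangentSpace (𝓡 4) (D.b y)) :
    tangentProj (𝓡 2) D.f y (D.de (D.b y) v) + D.Q y (D.de (D.b y) v) = D.de (D.b y) v :=
  D.tangentProj_add_Q_apply (D.de_mem_TN y v)

/-- The correction operator `A y = symProj y ∘ Q y`. [folklore] -/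
def A (y : S) : V →L[ℝ] V := (D.symProj y).comp (D.Q y)

/-- `A y w = symProj y (Q y w)`. [folklore] -/
theorem A_apply (y : S) (w : V) : D.A y w = D.symProj y (D.Q y w) := rfl

/-- `y ↦ A y` is smooth. [folklore] -/
theorem contMDiff_A : ContMDiff (𝓡 2) 𝓘(ℝ, V →L[ℝ] V) ∞ D.A :=
  D.contMDiff_symProj.clm_comp D.contMDiff_Q

/-! ### The normal retraction of the surface `f = e ∘ b` -/

section Retraction

variable [CompactSpace S] [Nonempty S]

/-- **Existence of the normal retraction** of the compact embedded surface `f : S → V`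
(the tree's `exists_normalRetraction`). [cite: HirschDT1976, Ch. 4 §5 Thm. 5.1] -/
theorem exists_retraction : ∃ ε : ℝ, 0 < ε ∧ IsOpen (normalTube (𝓡 2) D.f ε) ∧
    ContMDiffOn 𝓘(ℝ, V) (𝓡 2) ∞ (normalRetraction (𝓡 2) D.f ε) (normalTube (𝓡 2) D.f ε) ∧
    ∀ (y : S) (v : V), v ∈ normalSpace (𝓡 2) D.f y → ‖v‖ < ε →
      D.f y + v ∈ normalTube (𝓡 2) D.f ε ∧ normalRetraction (𝓡 2) D.f ε (D.f y + v) = y :=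
  exists_normalRetraction D.contMDiff_f D.f_injective D.hdf

/-- The normal radius of the surface. [folklore] -/
def rad : ℝ := D.exists_retraction.choose

/-- The defining properties of the normal radius. [folklore] -/
theorem rad_spec : 0 < D.rad ∧ IsOpen (normalTube (𝓡 2) D.f D.rad) ∧
    ContMDiffOn 𝓘(ℝ, V) (𝓡 2) ∞ (normalRetraction (𝓡 2) D.f D.rad) (normalTube (𝓡 2) D.f D.rad) ∧
    ∀ (y : S) (v : V), v ∈ normalSpace (𝓡 2) D.f y → ‖v‖ < D.rad →
      D.f y + v ∈ normalTube (𝓡 2) D.f D.rad ∧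
        normalRetraction (𝓡 2) D.f D.rad (D.f y + v) = y :=
  D.exists_retraction.choose_spec

/-- The open normal tube of the surface in `V`. [folklore] -/
def nTube : Set V := normalTube (𝓡 2) D.f D.rad

/-- **The normal retraction `r : V → S`** (meaningful on `nTube`). [folklore] -/
def r : V → S := normalRetraction (𝓡 2) D.f D.rad

/-- `dr_z : V →L ℝ²` (the tangent spaces of `S` are definitionally the model `ℝ²`). [folklore] -/
def dr (z : V) : V →L[ℝ] EuclideanSpace ℝ (Fin 2) := mfderiv 𝓘(ℝ, V) (𝓡 2) D.r z

/-- Unfolding of `dr`. [folklore] -/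
theorem dr_apply (z w : V) : D.dr z w = mfderiv 𝓘(ℝ, V) (𝓡 2) D.r z w := rfl

/-- The normal radius is positive. [folklore] -/
theorem rad_pos : 0 < D.rad := D.rad_spec.1

/-- The tube is open. [folklore] -/
theorem isOpen_nTube : IsOpen D.nTube := D.rad_spec.2.1

/-- The retraction is smooth on the tube. [folklore] -/
theorem contMDiffOn_r : ContMDiffOn 𝓘(ℝ, V) (𝓡 2) ∞ D.r D.nTube := D.rad_spec.2.2.1

/-- Short normal vectors end in the tube. [folklore] -/
theorem add_mem_nTube {y : S} {v : V} (hv : v ∈ (D.TS y)ᗮ) (hvr : ‖v‖ < D.rad) :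
    D.f y + v ∈ D.nTube :=
  (D.rad_spec.2.2.2 y v hv hvr).1

/-- **`r (f y + v) = y`** for short normal vectors `v`. [folklore] -/
theorem r_add {y : S} {v : V} (hv : v ∈ (D.TS y)ᗮ) (hvr : ‖v‖ < D.rad) : D.r (D.f y + v) = y :=
  (D.rad_spec.2.2.2 y v hv hvr).2

/-- The surface lies in the tube. [folklore] -/
theorem f_mem_nTube (y : S) : D.f y ∈ D.nTube := by
  simpa using D.add_mem_nTube (y := y) (Submodule.zero_mem _) (by simpa using D.rad_pos)

/-- `r ∘ f = id`. [folklore] -/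
theorem r_f (y : S) : D.r (D.f y) = y := by
  simpa using D.r_add (y := y) (Submodule.zero_mem _) (by simpa using D.rad_pos)

/-- The retraction is smooth at the points of the tube. [folklore] -/
theorem contMDiffAt_r {z : V} (hz : z ∈ D.nTube) : ContMDiffAt 𝓘(ℝ, V) (𝓡 2) ∞ D.r z :=
  (D.contMDiffOn_r z hz).contMDiffAt (D.isOpen_nTube.mem_nhds hz)

/-- The retraction is differentiable at the points of the tube. [folklore] -/
theorem mdifferentiableAt_r {z : V} (hz : z ∈ D.nTube) : MDifferentiableAt 𝓘(ℝ, V) (𝓡 2) D.r z :=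
  (D.contMDiffAt_r hz).mdifferentiableAt (by simp)

/-- **`dr (df c) = c`** (`r ∘ f = id`). [folklore] -/
theorem dr_df (y : S) (c : TangentSpace (𝓡 2) y) : D.dr (D.f y) (D.df y c) = c := by
  have hcomp : D.r ∘ D.f = id := funext D.r_f
  have h := mfderiv_comp y (D.mdifferentiableAt_r (D.f_mem_nTube y)) (D.mdifferentiableAt_f y)
  rw [hcomp, mfderiv_id] at h
  have h' := (ContinuousLinearMap.ext_iff.1 h c).symm
  exact h'

/-- **`dr` kills the normal vectors** (the retraction is constant on the normal segments).
[folklore] -/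
theorem dr_apply_of_mem_orthogonal {y : S} {v : V} (hv : v ∈ (D.TS y)ᗮ) : D.dr (D.f y) v = 0 := by
  -- the normal segment `t ↦ f y + t v`
  have hline : HasMFDerivAt 𝓘(ℝ, ℝ) 𝓘(ℝ, V) (fun t : ℝ ↦ D.f y + t • v) 0
      ((ContinuousLinearMap.id ℝ ℝ).smulRight v) :=
    (((hasFDerivAt_id (0 : ℝ)).smul_const v).const_add (D.f y)).hasMFDerivAt
  have hev : ∀ᶠ t : ℝ in 𝓝 0, D.r (D.f y + t • v) = y := by
    have hlt : ∀ᶠ t : ℝ in 𝓝 0, ‖t • v‖ < D.rad := by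
      have hc : Continuous fun t : ℝ ↦ ‖t • v‖ := by fun_prop
      have h0 : ‖(0 : ℝ) • v‖ < D.rad := by simpa using D.rad_pos
      exact hc.continuousAt.eventually_lt continuousAt_const h0
    filter_upwards [hlt] with t ht
    exact D.r_add ((D.TS y)ᗮ.smul_mem t hv) ht
  have hr : HasMFDerivAt 𝓘(ℝ, V) (𝓡 2) D.r ((fun t : ℝ ↦ D.f y + t • v) 0)
      (mfderiv 𝓘(ℝ, V) (𝓡 2) D.r (D.f y)) := by
    have h := (D.mdifferentiableAt_r (D.f_mem_nTube y)).hasMFDerivAt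
    have h0 : (fun t : ℝ ↦ D.f y + t • v) 0 = D.f y := by simp
    rw [h0]
    exact h
  have hcomp := hr.comp 0 hline
  have hconst : HasMFDerivAt 𝓘(ℝ, ℝ) (𝓡 2) (D.r ∘ fun t : ℝ ↦ D.f y + t • v) 0
      (0 : TangentSpace 𝓘(ℝ, ℝ) (0 : ℝ) →L[ℝ] TangentSpace (𝓡 2) y) := by
    refine (hasMFDerivAt_const (I := 𝓘(ℝ, ℝ)) (I' := 𝓡 2) y (0 : ℝ)).congr_of_eventuallyEq ?_
    filter_upwards [hev] with t ht
    exact ht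
  have huniq := hcomp.mfderiv.symm.trans hconst.mfderiv
  have h1 : D.dr (D.f y) ((1 : ℝ) • v) = 0 := ContinuousLinearMap.ext_iff.1 huniq 1
  rwa [one_smul] at h1

/-- **`df ∘ dr = Pˢ` at the surface.** [folklore] -/
theorem df_dr (y : S) (w : V) : D.df y (D.dr (D.f y) w) = tangentProj (𝓡 2) D.f y w := by
  obtain ⟨c, hc⟩ : tangentProj (𝓡 2) D.f y w ∈ D.TS y := tangentProj_apply_mem _ _ w
  change D.df y c = tangentProj (𝓡 2) D.f y w at hc
  have hn : w - tangentProj (𝓡 2) D.f y w ∈ (D.TS y)ᗮ := sub_tangentProj_apply_mem_orthogonal _ _ w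
  have hsplit : w = D.df y c + (w - tangentProj (𝓡 2) D.f y w) := by
    rw [hc]; exact (add_sub_cancel _ _).symm
  have h1 : D.dr (D.f y) w = D.dr (D.f y) (D.df y c) + D.dr (D.f y) (w - tangentProj (𝓡 2) D.f y w) := by
    conv_lhs => rw [hsplit]
    exact map_add _ _ _
  rw [h1, D.dr_df, D.dr_apply_of_mem_orthogonal hn, add_zero, hc]

/-! ### The retraction `π₀ = r ∘ e` of a neighbourhood of the surface in `N` -/

/-- The open set `N₀ = e⁻¹(tube) ⊇ b(S)`. [folklore] -/
def N₀ : Set N := D.e ⁻¹' D.nTube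

/-- `N₀` is open. [folklore] -/
theorem isOpen_N₀ : IsOpen D.N₀ := D.isOpen_nTube.preimage D.he.continuous

/-- The surface lies in `N₀`. [folklore] -/
theorem b_mem_N₀ (y : S) : D.b y ∈ D.N₀ := D.f_mem_nTube y

/-- **The retraction `π₀ = r ∘ e`.** [folklore] -/
def π₀ (x : N) : S := D.r (D.e x)

/-- `dπ₀_x : T_x N →L ℝ²`. [folklore] -/
def dπ₀ (x : N) : TangentSpace (𝓡 4) x →L[ℝ] EuclideanSpace ℝ (Fin 2) :=
  mfderiv (𝓡 4) (𝓡 2) D.π₀ x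

/-- `π₀ ∘ b = id`. [folklore] -/
theorem π₀_b (y : S) : D.π₀ (D.b y) = y := D.r_f y

/-- `π₀` is smooth on `N₀`. [folklore] -/
theorem contMDiffOn_π₀ : ContMDiffOn (𝓡 4) (𝓡 2) ∞ D.π₀ D.N₀ :=
  D.contMDiffOn_r.comp D.he.contMDiffOn fun _ hx ↦ hx

/-- `π₀` is smooth at the points of `N₀`. [folklore] -/
theorem contMDiffAt_π₀ {x : N} (hx : x ∈ D.N₀) : ContMDiffAt (𝓡 4) (𝓡 2) ∞ D.π₀ x :=
  (D.contMDiffOn_π₀ x hx).contMDiffAt (D.isOpen_N₀.mem_nhds hx)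

/-- `π₀` is differentiable at the points of `N₀`. [folklore] -/
theorem mdifferentiableAt_π₀ {x : N} (hx : x ∈ D.N₀) : MDifferentiableAt (𝓡 4) (𝓡 2) D.π₀ x :=
  (D.contMDiffAt_π₀ hx).mdifferentiableAt (by simp)

/-- Chain rule for `π₀` at the surface: `dπ₀ v = dr (de v)`. [folklore] -/
theorem dπ₀_apply (y : S) (v : TangentSpace (𝓡 4) (D.b y)) :
    D.dπ₀ (D.b y) v = D.dr (D.f y) (D.de (D.b y) v) := by
  have hr : MDifferentiableAt 𝓘(ℝ, V) (𝓡 2) D.r (D.e (D.b y)) :=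
    D.mdifferentiableAt_r (D.f_mem_nTube y)
  have hchain := mfderiv_comp (D.b y) hr (D.mdifferentiableAt_e _)
  exact ContinuousLinearMap.ext_iff.1 hchain v

/-- **`df ∘ dπ₀ = Pˢ ∘ de` at the surface.** [folklore] -/
theorem df_dπ₀ (y : S) (v : TangentSpace (𝓡 4) (D.b y)) :
    D.df y (D.dπ₀ (D.b y) v) = tangentProj (𝓡 2) D.f y (D.de (D.b y) v) := by
  rw [dπ₀_apply, df_dr]

/-! ### The corrected retraction `π₁` with symplectically orthogonal fibres -/

/-- **The corrected endpoint** `ept x = e x + A_{π₀ x}(e x - f (π₀ x))`. [folklore] -/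
def ept (x : N) : V := D.e x + D.A (D.π₀ x) (D.e x - D.f (D.π₀ x))

/-- `d(ept)_x : T_x N →L V`. [folklore] -/
def dept (x : N) : TangentSpace (𝓡 4) x →L[ℝ] V := mfderiv (𝓡 4) 𝓘(ℝ, V) D.ept x

/-- The deviation `e x - f (π₀ x)` vanishes on the surface. [folklore] -/
theorem e_sub_f_π₀_b (y : S) : D.e (D.b y) - D.f (D.π₀ (D.b y)) = 0 := by
  rw [π₀_b, f_apply, sub_self]

/-- `ept ∘ b = f`. [folklore] -/
theorem ept_b (y : S) : D.ept (D.b y) = D.f y := by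
  rw [ept, e_sub_f_π₀_b, map_zero, add_zero]; rfl

/-- `ept` is smooth on `N₀`. [folklore] -/
theorem contMDiffOn_ept : ContMDiffOn (𝓡 4) 𝓘(ℝ, V) ∞ D.ept D.N₀ :=
  D.he.contMDiffOn.add ((D.contMDiff_A.comp_contMDiffOn D.contMDiffOn_π₀).clm_apply
    (D.he.contMDiffOn.sub (D.contMDiff_f.comp_contMDiffOn D.contMDiffOn_π₀)))

/-- The open set `N₁ ⊆ N₀` where the corrected endpoint stays in the tube. [folklore] -/
def N₁ : Set N := D.N₀ ∩ D.ept ⁻¹' D.nTube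

/-- `N₁` is open. [folklore] -/
theorem isOpen_N₁ : IsOpen D.N₁ :=
  D.contMDiffOn_ept.continuousOn.isOpen_inter_preimage D.isOpen_N₀ D.isOpen_nTube

/-- `N₁ ⊆ N₀`. [folklore] -/
theorem N₁_subset_N₀ : D.N₁ ⊆ D.N₀ := inter_subset_left

/-- The surface lies in `N₁`. [folklore] -/
theorem b_mem_N₁ (y : S) : D.b y ∈ D.N₁ :=
  ⟨D.b_mem_N₀ y, by rw [mem_preimage, ept_b]; exact D.f_mem_nTube y⟩

/-- `N₁` is a neighbourhood of each point of the surface. [folklore] -/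
theorem N₁_mem_nhds (y : S) : D.N₁ ∈ 𝓝 (D.b y) := D.isOpen_N₁.mem_nhds (D.b_mem_N₁ y)

/-- **The corrected retraction** `π₁ x = r (e x + A_{π₀ x}(e x - f (π₀ x)))`.
[cite: McDuffSalamon2017, proof of Thm. 3.4.10] -/
def π₁ (x : N) : S := D.r (D.ept x)

/-- `dπ₁_x : T_x N →L ℝ²`. [folklore] -/
def dπ₁ (x : N) : TangentSpace (𝓡 4) x →L[ℝ] EuclideanSpace ℝ (Fin 2) :=
  mfderiv (𝓡 4) (𝓡 2) D.π₁ x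

/-- `π₁ ∘ b = id`. [folklore] -/
theorem π₁_b (y : S) : D.π₁ (D.b y) = y := by
  rw [π₁, ept_b, r_f]

/-- `π₁` is smooth on `N₁`. [folklore] -/
theorem contMDiffOn_π₁ : ContMDiffOn (𝓡 4) (𝓡 2) ∞ D.π₁ D.N₁ :=
  D.contMDiffOn_r.comp (D.contMDiffOn_ept.mono D.N₁_subset_N₀) fun _ hx ↦ hx.2

/-- `π₁` is smooth at the points of `N₁`. [folklore] -/
theorem contMDiffAt_π₁ {x : N} (hx : x ∈ D.N₁) : ContMDiffAt (𝓡 4) (𝓡 2) ∞ D.π₁ x :=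
  (D.contMDiffOn_π₁ x hx).contMDiffAt (D.isOpen_N₁.mem_nhds hx)

/-- `π₁` is differentiable at the points of `N₁`. [folklore] -/
theorem mdifferentiableAt_π₁ {x : N} (hx : x ∈ D.N₁) : MDifferentiableAt (𝓡 4) (𝓡 2) D.π₁ x :=
  (D.contMDiffAt_π₁ hx).mdifferentiableAt (by simp)

/-- `ept` is differentiable at the points of `N₀`. [folklore] -/
theorem mdifferentiableAt_ept {x : N} (hx : x ∈ D.N₀) : MDifferentiableAt (𝓡 4) 𝓘(ℝ, V) D.ept x :=
  ((D.contMDiffOn_ept x hx).contMDiffAt (D.isOpen_N₀.mem_nhds hx)).mdifferentiableAt (by simp)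

/-- **The differential of the corrected endpoint at the surface**:
`d(ept)_{b y} v = de v + symProj (Q (de v))`. [folklore] -/
theorem dept_apply (y : S) (v : TangentSpace (𝓡 4) (D.b y)) :
    D.dept (D.b y) v = D.de (D.b y) v + D.symProj y (D.Q y (D.de (D.b y) v)) := by
  have hx : D.b y ∈ D.N₀ := D.b_mem_N₀ y
  have hπ : MDifferentiableAt (𝓡 4) (𝓡 2) D.π₀ (D.b y) := D.mdifferentiableAt_π₀ hx
  have hg : MDifferentiableAt (𝓡 4) 𝓘(ℝ, V →L[ℝ] V) (fun x ↦ D.A (D.π₀ x)) (D.b y) :=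
    ((D.contMDiff_A _).mdifferentiableAt (by simp)).comp (D.b y) hπ
  have hfπ : MDifferentiableAt (𝓡 4) 𝓘(ℝ, V) (fun x ↦ D.f (D.π₀ x)) (D.b y) :=
    (D.mdifferentiableAt_f _).comp (D.b y) hπ
  have hdev : MDifferentiableAt (𝓡 4) 𝓘(ℝ, V) (fun x ↦ D.e x - D.f (D.π₀ x)) (D.b y) :=
    (D.mdifferentiableAt_e _).sub hfπ
  -- `V`-valued names for the auxiliary differentials
  set ddev : TangentSpace (𝓡 4) (D.b y) →L[ℝ] V :=
    mfderiv (𝓡 4) 𝓘(ℝ, V) (fun x ↦ D.e x - D.f (D.π₀ x)) (D.b y) with hddev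
  set corr : TangentSpace (𝓡 4) (D.b y) →L[ℝ] V :=
    mfderiv (𝓡 4) 𝓘(ℝ, V) (fun x ↦ D.A (D.π₀ x) (D.e x - D.f (D.π₀ x))) (D.b y) with hcorr
  -- product rule at the zero `e (b y) - f (π₀ (b y)) = 0`
  have hprod : corr v = D.A (D.π₀ (D.b y)) (ddev v) :=
    mfderiv_clm_apply_of_eq_zero hg hdev (D.e_sub_f_π₀_b y) v
  -- the differential of the deviation
  have hfπc : mfderiv (𝓡 4) 𝓘(ℝ, V) (fun x ↦ D.f (D.π₀ x)) (D.b y) =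
      (D.df (D.π₀ (D.b y))).comp (D.dπ₀ (D.b y)) :=
    mfderiv_comp (D.b y) (D.mdifferentiableAt_f (D.π₀ (D.b y))) hπ
  have h2 : ddev = D.de (D.b y) - (D.df (D.π₀ (D.b y))).comp (D.dπ₀ (D.b y)) :=
    (mfderiv_sub (D.mdifferentiableAt_e (D.b y)) hfπ).trans
      (congrArg (fun X : TangentSpace (𝓡 4) (D.b y) →L[ℝ] V ↦ D.de (D.b y) - X) hfπc)
  have hdev' : ddev v = D.de (D.b y) v - tangentProj (𝓡 2) D.f y (D.de (D.b y) v) := by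
    have h3 : ddev v = D.de (D.b y) v - D.df (D.π₀ (D.b y)) (D.dπ₀ (D.b y) v) := by
      rw [h2]; rfl
    rw [h3, D.π₀_b, df_dπ₀]
  -- the sum rule
  have hsum : D.dept (D.b y) = D.de (D.b y) + corr :=
    mfderiv_add (D.mdifferentiableAt_e (D.b y)) (hg.clm_apply hdev)
  have key : D.dept (D.b y) v = D.de (D.b y) v + corr v := by
    rw [hsum]; rfl
  rw [key, hprod, hdev', D.π₀_b, A_apply, map_sub,
    D.Q_apply_eq_zero_of_mem_TS (tangentProj_apply_mem _ _ _), sub_zero]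

/-- Chain rule for `π₁` at the surface: `dπ₁ v = dr (d(ept) v)`. [folklore] -/
theorem dπ₁_apply (y : S) (v : TangentSpace (𝓡 4) (D.b y)) :
    D.dπ₁ (D.b y) v = D.dr (D.f y) (D.dept (D.b y) v) := by
  have hr : MDifferentiableAt 𝓘(ℝ, V) (𝓡 2) D.r (D.ept (D.b y)) := by
    rw [ept_b]; exact D.mdifferentiableAt_r (D.f_mem_nTube y)
  have hchain := mfderiv_comp (D.b y) hr (D.mdifferentiableAt_ept (D.b_mem_N₀ y))
  have h1 : D.dπ₁ (D.b y) v = D.dr (D.ept (D.b y)) (D.dept (D.b y) v) :=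
    ContinuousLinearMap.ext_iff.1 hchain v
  rw [h1, ept_b]

/-- **The differential of the corrected retraction at the surface**:
`df (dπ₁ v) = Pˢ (de v) + symProj (Q (de v))`. [cite: McDuffSalamon2017, proof of Thm. 3.4.10] -/
theorem df_dπ₁ (y : S) (v : TangentSpace (𝓡 4) (D.b y)) :
    D.df y (D.dπ₁ (D.b y) v) =
      tangentProj (𝓡 2) D.f y (D.de (D.b y) v) + D.symProj y (D.Q y (D.de (D.b y) v)) := by
  rw [dπ₁_apply, df_dr, dept_apply, map_add,
    tangentProj_apply_of_mem (D.symProj_apply_mem y _)]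

/-- `df (dπ₁ v) ∈ TS`, with `Q`-component zero: **the kernel of `dπ₁` at the surface is
`{Q w - symProj (Q w)} = TS^ω`**; precisely `dπ₁ v = 0 ↔ Pˢ (de v) + symProj (Q (de v)) = 0`.
[folklore] -/
theorem dπ₁_eq_zero_iff (y : S) (v : TangentSpace (𝓡 4) (D.b y)) :
    D.dπ₁ (D.b y) v = 0 ↔
      tangentProj (𝓡 2) D.f y (D.de (D.b y) v) + D.symProj y (D.Q y (D.de (D.b y) v)) = 0 := by
  rw [← df_dπ₁]
  constructor
  · intro h; rw [h]; exact (D.df y).map_zero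
  · intro h; exact D.df_injective y (h.trans (D.df y).map_zero.symm)

/-- `dπ₁ ∘ db = id`. [folklore] -/
theorem dπ₁_mfderiv_b (y : S) (c : TangentSpace (𝓡 2) y) :
    D.dπ₁ (D.b y) (mfderiv (𝓡 2) (𝓡 4) D.b y c) = c := by
  apply D.df_injective y
  rw [df_dπ₁, ← df_eq_de_mfderiv_b, tangentProj_apply_of_mem (D.df_mem_TS y c),
    D.Q_apply_eq_zero_of_mem_TS (D.df_mem_TS y c), map_zero, add_zero]

/-! ### The normal coordinate -/

/-- **The normal coordinate** `nrm x = Q_{π₁ x}(e x - f (π₁ x)) ∈ F (π₁ x)`. [folklore] -/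
def nrm (x : N) : V := D.Q (D.π₁ x) (D.e x - D.f (D.π₁ x))

/-- `d(nrm)_x : T_x N →L V`. [folklore] -/
def dnrm (x : N) : TangentSpace (𝓡 4) x →L[ℝ] V := mfderiv (𝓡 4) 𝓘(ℝ, V) D.nrm x

/-- `nrm x ∈ F (π₁ x)`. [folklore] -/
theorem nrm_mem_F (x : N) : D.nrm x ∈ D.F (D.π₁ x) := D.Q_apply_mem _ _

/-- `Q (nrm x) = nrm x`. [folklore] -/
theorem Q_nrm (x : N) : D.Q (D.π₁ x) (D.nrm x) = D.nrm x := D.Q_apply_eq_self_iff.2 (D.nrm_mem_F x)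

/-- The deviation `e x - f (π₁ x)` vanishes on the surface. [folklore] -/
theorem e_sub_f_π₁_b (y : S) : D.e (D.b y) - D.f (D.π₁ (D.b y)) = 0 := by
  rw [π₁_b, f_apply, sub_self]

/-- `nrm ∘ b = 0`. [folklore] -/
theorem nrm_b (y : S) : D.nrm (D.b y) = 0 := by
  rw [nrm, e_sub_f_π₁_b, map_zero]

/-- `nrm` is smooth on `N₁`. [folklore] -/
theorem contMDiffOn_nrm : ContMDiffOn (𝓡 4) 𝓘(ℝ, V) ∞ D.nrm D.N₁ :=
  (D.contMDiff_Q.comp_contMDiffOn D.contMDiffOn_π₁).clm_apply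
    ((D.he.contMDiffOn.mono (D.N₁_subset_N₀.trans fun _ _ ↦ trivial)).sub
      (D.contMDiff_f.comp_contMDiffOn D.contMDiffOn_π₁))

/-- `nrm` is smooth at the points of `N₁`. [folklore] -/
theorem contMDiffAt_nrm {x : N} (hx : x ∈ D.N₁) : ContMDiffAt (𝓡 4) 𝓘(ℝ, V) ∞ D.nrm x :=
  (D.contMDiffOn_nrm x hx).contMDiffAt (D.isOpen_N₁.mem_nhds hx)

/-- `nrm` is differentiable at the points of `N₁`. [folklore] -/
theorem mdifferentiableAt_nrm {x : N} (hx : x ∈ D.N₁) : MDifferentiableAt (𝓡 4) 𝓘(ℝ, V) D.nrm x :=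
  (D.contMDiffAt_nrm hx).mdifferentiableAt (by simp)

/-- **The differential of the normal coordinate at the surface: `d(nrm)_{b y} v = Q (de v)`.**
[folklore] -/
theorem dnrm_apply (y : S) (v : TangentSpace (𝓡 4) (D.b y)) :
    D.dnrm (D.b y) v = D.Q y (D.de (D.b y) v) := by
  have hx : D.b y ∈ D.N₁ := D.b_mem_N₁ y
  have hπ : MDifferentiableAt (𝓡 4) (𝓡 2) D.π₁ (D.b y) := D.mdifferentiableAt_π₁ hx
  have hg : MDifferentiableAt (𝓡 4) 𝓘(ℝ, V →L[ℝ] V) (fun x ↦ D.Q (D.π₁ x)) (D.b y) :=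
    ((D.contMDiff_Q _).mdifferentiableAt (by simp)).comp (D.b y) hπ
  have hfπ : MDifferentiableAt (𝓡 4) 𝓘(ℝ, V) (fun x ↦ D.f (D.π₁ x)) (D.b y) :=
    (D.mdifferentiableAt_f _).comp (D.b y) hπ
  have hdev : MDifferentiableAt (𝓡 4) 𝓘(ℝ, V) (fun x ↦ D.e x - D.f (D.π₁ x)) (D.b y) :=
    (D.mdifferentiableAt_e _).sub hfπ
  set ddev : TangentSpace (𝓡 4) (D.b y) →L[ℝ] V :=
    mfderiv (𝓡 4) 𝓘(ℝ, V) (fun x ↦ D.e x - D.f (D.π₁ x)) (D.b y) with hddev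
  have hprod : D.dnrm (D.b y) v = D.Q (D.π₁ (D.b y)) (ddev v) :=
    mfderiv_clm_apply_of_eq_zero hg hdev (D.e_sub_f_π₁_b y) v
  have hfπc : mfderiv (𝓡 4) 𝓘(ℝ, V) (fun x ↦ D.f (D.π₁ x)) (D.b y) =
      (D.df (D.π₁ (D.b y))).comp (D.dπ₁ (D.b y)) :=
    mfderiv_comp (D.b y) (D.mdifferentiableAt_f (D.π₁ (D.b y))) hπ
  have h2 : ddev = D.de (D.b y) - (D.df (D.π₁ (D.b y))).comp (D.dπ₁ (D.b y)) :=
    (mfderiv_sub (D.mdifferentiableAt_e (D.b y)) hfπ).trans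
      (congrArg (fun X : TangentSpace (𝓡 4) (D.b y) →L[ℝ] V ↦ D.de (D.b y) - X) hfπc)
  have hdev' : ddev v = D.de (D.b y) v - D.df y (D.dπ₁ (D.b y) v) := by
    have h3 : ddev v = D.de (D.b y) v - D.df (D.π₁ (D.b y)) (D.dπ₁ (D.b y) v) := by
      rw [h2]; rfl
    rw [h3, D.π₁_b]
  rw [hprod, hdev', D.π₁_b, df_dπ₁, map_sub, map_add,
    D.Q_apply_eq_zero_of_mem_TS (tangentProj_apply_mem _ _ _),
    D.Q_apply_eq_zero_of_mem_TS (D.symProj_apply_mem y _), add_zero, sub_zero]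

/-- **`(π₁, nrm)` is an immersion along the surface**: `dπ₁ v = 0` and `d(nrm) v = 0` force
`v = 0`. [folklore] -/
theorem eq_zero_of_dπ₁_eq_zero_of_dnrm_eq_zero (y : S) (v : TangentSpace (𝓡 4) (D.b y))
    (h₁ : D.dπ₁ (D.b y) v = 0) (h₂ : D.dnrm (D.b y) v = 0) : v = 0 := by
  rw [dnrm_apply] at h₂
  rw [dπ₁_eq_zero_iff, h₂, map_zero, add_zero] at h₁
  have hsplit := D.tangentProj_de_add_Q_de y v
  rw [h₁, h₂, add_zero] at hsplit
  exact D.de_injective (D.b y) (by rw [← hsplit, map_zero])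

/-- On the tangent directions of the surface `d(nrm)` vanishes: `d(nrm) (db c) = 0`. [folklore] -/
theorem dnrm_mfderiv_b (y : S) (c : TangentSpace (𝓡 2) y) :
    D.dnrm (D.b y) (mfderiv (𝓡 2) (𝓡 4) D.b y c) = 0 := by
  rw [dnrm_apply, ← df_eq_de_mfderiv_b, D.Q_apply_eq_zero_of_mem_TS (D.df_mem_TS y c)]

end Retraction

end Setup

end SurfaceTube

end Literature.Geometry.Symplectic
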